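import Mathlib
import HarnessLib
import HarnessLib.Audit
import Summits.Langlands.Statement
import Literature.NumberTheory.Automorphic.LocalLanglandsGLProofs
import Literature.NumberTheory.Automorphic.LocalConstantsProofs
import HarnessLib.Audit.Status.Attr

/-!
Route: SenNullAlignment

DORMANT since 2026-08-23T20:53:18Z (reconciler: no traction for 6.2 d (last activity item-evidence-added at 2026-08-17T14:32:31Z); parked, not closed — `ledger route dormant route-Langlands-SenNullAlignment --off` to reactivate) — unstaffed, not closed; items shared with open routes are served there. `ledger route dormant <id> --off` reactivates.

# Route SenNullAlignment — partial weight one reciprocity by Sen-null alignment — Hodge–Tate nullity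
at the singular embeddings kills monodromy at alignable places

X = OddHilbertReciprocity ("it suffices to show"): direction (A) of the summit for n = 2 over every
totally real K, restricted
to the L-algebraic cuspidal π of GL₂(𝔸_K) that are holomorphic of some weight (k, w) (infinity type
of D_{k_β,w} at every β: the tree's `hilbertInfinityType k w`, INLINED over the Statement cone since
the cone repair of 2026-08-16 — `IsHolomorphicHilbert k w` by `Iff.rfl`) with TOTALLY ODD central
sign (the idèle −1 at each infinite place — Mathlib's `Units.map inl ∘ mulSingle`, definitionally
the tree's
`infiniteIdeleSingle u (-1)` — acts by −1; this excludes the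
Maass-type components that share a weight-one infinity type): for every such π and every ℓ, ι there
is an irreducible ρ, geometric for
Fontaine's pinned datum, with `Corresponds RD ι π ρ` (Satake a.e. + local–global compatibility at
EVERY finite place), for ONE RD per K
(uniqueness up to conjugacy is a theorem given existence — Chebotarev + Brauer–Nesbitt — and is not
restated). The open part is PARTIAL (and parallel) weight one — the printed open question of Newton
2015 §1.1 /
Remark 5 and Moy–Specter 2015 Remark 1.1; odd regular weights are the in-tree named fact
`galoisRep_GL2_totallyReal_localGlobal`.
X → Langlands is the junction item SectorComplement (hub convention for sector routes on the
all-fields/all-ranks summit).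
Lean: `∀ (K : Type) [Field K] [NumberField K], NumberField.IsTotallyReal K → ∃ RD :
Summit.Langlands.ReciprocityData K, ∀ (hcpt :
Literature.NumberTheory.Automorphic.isCompact_glFiniteIntegralLevel 2 K) (π :
Literature.NumberTheory.Automorphic.CuspidalAutomorphicRepData 2 K hcpt) (k : (K →+* ℂ) → ℕ) (w :
ℤ), π.1.IsLAlgebraic → π.1.HasInfinityType (fun β : K →+* ℂ => ({(⟨((k β : ℂ) - 1 - w) / 2, (1 - (k
β : ℂ) - w) / 2, (k β : ℤ) - 1, by push_cast; ring⟩ :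
Literature.NumberTheory.Automorphic.ArchWeight), (⟨((k β : ℂ) - 1 - w) / 2, (1 - (k β : ℂ) - w) / 2,
(k β : ℤ) - 1, by push_cast; ring⟩ : Literature.NumberTheory.Automorphic.ArchWeight).swap} :
Multiset Literature.NumberTheory.Automorphic.ArchWeight)) → (∀ (u : NumberField.InfinitePlace K), ∀
φ ∈ π.1.W, Literature.NumberTheory.Automorphic.rightTranslation
(Literature.NumberTheory.Automorphic.AdelicGroupData.gl 2 K) (Matrix.GeneralLinearGroup.scalar (Fin
2) (Units.map (MonoidHom.inl (NumberField.InfiniteAdeleRing K) (IsDedekindDomain.FiniteAdeleRing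
(NumberField.RingOfIntegers K) K) : NumberField.InfiniteAdeleRing K →* NumberField.AdeleRing
(NumberField.RingOfIntegers K) K) (Units.map (MonoidHom.mulSingle (fun u' :
NumberField.InfinitePlace K => u'.Completion) u : u.Completion →* NumberField.InfiniteAdeleRing K)
(-1)))) φ + φ ∈ π.1.W') → ∀ (ℓ : ℕ) [Fact ℓ.Prime] (ι : PadicAlgCl ℓ ≃+* ℂ), ∃ ρ :
Literature.NumberTheory.GaloisRepresentations.FramedGaloisRep K (PadicAlgCl ℓ) 2,
ρ.toGaloisRep.IsIrreducible ∧ Summit.Langlands.IsGeometricFramed RD ρ ∧ Summit.Langlands.Corresponds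
RD ι π.1 ρ`

## Assembly
Pure logic, CHECKED (glue.lean `closes` is the deciding theorem, re-certified natively at rev 6
after the cone repair): fix K totally real, take RD from RegularServed;
for π L-algebraic, holomorphic of weight (k,w), odd: if no k_β = 1 the infinity type is regular
(proved inline in `closes`; = `hilbertInfinityType_isRegular`) and
RegularServed gives the conclusion; else OddNonRegularAttached gives ρ, and place by place: v ∤ ℓ →
AwayFromEll;
v ∣ ℓ fully aligned → SingularProjectiveFinite then AlignedAtEll; v ∣ ℓ not aligned →
NonAlignedAtEll; the a.e.-unramified clause of
IsGeometricFramed is read off the Satake clause; SectorComplement carries X to `Langlands`. The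
deciding theorem assumes the seven
cruxes only (ruling 2026-08-16); three of them (OddNonRegularAttached, RegularServed,
SectorComplement) are junction / literature items.

Rationale: WHY THIS LINE. The Galois representations of partial weight one forms exist only through congruences
(Jarvis1997), so every printed attack on their
local–global compatibility is a classicality argument in a p-adic family (Newton2015LowWeight:
level-lowering + Kassaei gluing at v ∤ p;
BoxerPilloni2021HigherColeman Thm 23: Kisin periods for regular principal series at v ∣ p) and
stalls exactly when π is special above p
("seems to require a new idea", Newton §1.1). The new lever is arithmetic, not automorphic: at a
weight-one embedding τ the predicted
Hodge–Tate weights COINCIDE, so once the τ-Sen operator of Jarvis's ρ is shown to VANISH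
(semisimplicity, to be read off the classical
coherent class by geometric Sen theory on the Hilbert modular variety — PanLocallyAnalyticII2022,
RodriguezCamargo2022GeometricSen,
Jiang2026ClassicalityHilbert, run in direction (A)), Sen's finiteness theorem (Sen1973) makes
ρ|Γ_{K_v} potentially unramified up to
twist at every place v all of whose ℓ-adic embeddings read weight one; Aut(ℂ)-conjugation of π
permutes the weights, so every place of
small residue degree is alignable for some ι, which kills the monodromy operator there before any
automorphic input and isolates the
genuinely semistable residue to non-alignable special places (Moy–Specter's only example: Steinberg
at the INERT prime 2 of ℚ(√5) —
consistent); at non-aligned places the same nullity plus Ding's automatic partial de Rhamness at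
regular embeddings
(Ding2014PartiallyDeRham) reduces LGC to period matching and ONE monodromy statement. Imported:
p-adic Hodge theory of the singular
embedding (Sen theory, partially de Rham (φ,Γ)-modules) and perfectoid geometric Sen theory; no
patching, no p-adic local Langlands.
Nothing among the 42 open routes touches partial weight one; Sen theory appears in the hub only as
BCGP's Sen = Cousin classicality
inside direction-(B) cruxes (PicardMuOrdinary, TrigonalHeartLimit); EisensteinMonodromy /
SteinbergVelocityDst PRODUCE N ≠ 0 for
CM torsion classes, whereas here the lever KILLS N at alignable places of Hilbert partial weight
one. Negatives index: 1 unrelated entry.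

RANKED CRUXES. #0 OddHilbertReciprocity (target) — direction (A) for n = 2 over totally real K
restricted to L-algebraic cuspidal π holomorphic of weight (k, w) with totally odd central sign: ∀ K
totally real ∃ RD ∀ such π ∀ ℓ ι ∃ ρ irreducible, IsGeometricFramed RD ρ, Corresponds RD ι π ρ
(partial/parallel weight one = open part; odd regular weights = in-tree fact; uniqueness up to
conjugacy not restated). (why it might fail: it is Buzzard–Gee 3.2.2 / Taylor Conj. 7 for partial
weight one: a non-CM partial-weight-one newform whose attached ρ has N = 0 at a special place for
some ℓ, or is not de Rham above ℓ, refutes it; as typed only through the ∃RD / pinned-pst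
conventions shared with the summit.) [Jarvis1997, Newton2015LowWeight, MoySpecter2015,
BuzzardGeeLMS2014, Skinner2009]
#2 SingularProjectiveFinite (crux) — (THE LEVER) K totally real; π cuspidal on GL₂(𝔸_K),
L-algebraic, holomorphic of weight (k, w), totally odd, with some k_β = 1; ℓ, ι; ρ : Γ_K → GL₂(ℚ̄_ℓ)
irreducible and Satake–Frobenius compatible with π at almost all v. Then at every v ∣ ℓ all of whose
ℓ-adic embeddings τ : K → ℚ̄_ℓ (those with ‖τ x‖ < 1 on v) read weight one, k(ι ∘ τ) = 1, the image
of every inertia group above v under ρ is finite modulo scalars. Intended proof: Sen weights {m, m}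
at such τ (BoxerPilloni Thm 23 (3)) + τ-Hodge–Tate NULLITY of the classical eigensystem via
geometric Sen theory (π_HT differential operators on the perfectoid Hilbert modular variety; Pan II
§§5–6 for modular curves, Jiang 2026 for regular Hilbert weights) + Sen 1973 (Θ = 0 ⇒ finite inertia
after the cyclotomic twist ε^m). [difficulty: open-problem] (why it might fail: needs Sen
SEMISIMPLICITY (Θ_τ = 0), not the known Sen weights: a classical partial-weight-one π whose ρ is
τ-Hodge–Tate-defective at an aligned place (nothing proved forbids it; cf. non-classical weight-1
points in Pan II) refutes it; it also asserts the HT recipe (BG Rem. 3.2.3) the summit omits.)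
[Sen1973, BoxerPilloni2021HigherColeman, PanLocallyAnalyticII2022, RodriguezCamargo2022GeometricSen,
Jiang2026ClassicalityHilbert, MoySpecter2015, arXiv:2603.27937]
#3 NonAlignedAtEll (crux) — (HARDEST RESIDUE) for every RD serving the regular Hilbert case
(hypothesis: every L-algebraic cuspidal π' of regular infinity type has, for all ℓ', ι', an
irreducible geometric ρ' with Corresponds RD ι' π' ρ'), every π, ρ as in SingularProjectiveFinite
and every v ∣ ℓ that is NOT fully aligned: LocalGlobalCompatibleAt RD ι π ρ v and ρ|Γ_{K_v} is de
Rham for Fontaine's pinned datum. Contains the printed open case — π_v special at an inert-type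
place (Moy–Specter: Steinberg at the inert 2 of ℚ(√5)), i.e. semistable non-crystalline LGC with N ≠
0 for a congruence-built ρ; after Sen-nullity at the singular τ and Ding's automatic τ-de Rhamness
at the regular τ (weights differ by k_τ − 1 ≥ 2) it is Kisin-type period matching plus ONE monodromy
statement; BoxerPilloni Thm 23 (4) already covers π_v a regular principal series. [deps:
SingularProjectiveFinite] [difficulty: open-problem] (why it might fail: N ≠ 0 at a special v ∣ ℓ
for Jarvis's ρ is Newton's 'new idea needed' case verbatim; non-distinguished PS and ℓ = 2
exceptional supercuspidals lack an eigenvariety handle; stated ∀ RD serving regular forms (bets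
partial-weight-one local components are tempered).) [Newton2015LowWeight, MoySpecter2015,
BoxerPilloni2021HigherColeman, Ding2014PartiallyDeRham, Ding2015LinvariantsPartiallyDeRham,
Kisin2003]
#4 AlignedAtEll (crux) — same setting; v ∣ ℓ fully aligned and the inertia image finite modulo
scalars (the output of SingularProjectiveFinite): then LocalGlobalCompatibleAt RD ι π ρ v and de
Rham at v. Content: ρ|Γ_v ≅ χ ⊗ ρ₀ with ρ₀ potentially unramified, so de Rham ⇔ χ Hodge–Tate; WD
matching = Galois type of ρ₀ versus inertial type of π_v and Frobenius versus U_v —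
Kisin/Boxer–Pilloni crystalline periods on the Hilbert eigenvariety after a solvable totally real
base change killing the type, Brauer induction on the Weil side; it FORCES π_v non-special at every
alignable place (the route's falsifiable prediction: no partial-weight-one newform is Steinberg at a
split prime carrying weight one). [deps: SingularProjectiveFinite] [difficulty: XL] (why it might
fail: at an aligned v with π_v special it needs an automorphic contradiction (Galois N = 0 vs
Steinberg) nobody has derived; supercuspidal π_v at ℓ = 2 after base change; weight-one
companion/critical points of the eigenvariety where Kisin's period argument degenerates.)
[BoxerPilloni2021HigherColeman, Kisin2003, Skinner2009, HarrisTaylorAMS2001, Newton2015LowWeight]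
#5 AwayFromEll (crux) — same setting, v ∤ ℓ: LocalGlobalCompatibleAt RD ι π ρ v. In print when π_v
is not special (Jarvis 1997 Thm 1 of Newton's summary; Carayol, Rogawski–Tunnell for parallel weight
one) and, when π_v is special, under Newton's hypotheses at ℓ (ℓ unramified in K, π_w unramified
ℓ-distinguished principal series ∀ w ∣ ℓ, ρ̄ irreducible); open residue: π_v special while π_w is
special at some w ∣ ℓ (by AlignedAtEll only non-alignable w). [difficulty: L] (why it might fail:
the residue is Newton 2015 §1.1's excluded case (N_v ≠ 0 for the ℓ-adic member when π is Steinberg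
above ℓ): level-lowering + Kassaei gluing has no classicality theorem for Steinberg-at-ℓ partial
weight one, and purity (which would give N ≠ 0) is unavailable for congruence-built ρ.) [Jarvis1997,
Newton2015LowWeight, RogawskiTunnell1983, CarayolASENS1986]
#6 OddNonRegularAttached (crux) — (LITERATURE TRANSCRIPTION — kinded crux only because the deciding
theorem may assume crux items, ruling 2026-08-16; lowest staffing) existence, known in print: for π
as above (some k_β = 1) and every ℓ, ι there is an irreducible ρ Satake–Frobenius compatible with π
at almost all v in the summit's arithmetic-Frobenius L-normalisation — Jarvis 1997 (congruences in
coherent cohomology; parallel weight one: Rogawski–Tunnell), irreducibility by Ribet's argument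
(Jarvis §3 / Taylor), also BoxerPilloni Thm 23 (1)–(2); the twist bookkeeping is that of the tree's
L-normalised regular statement. [difficulty: L] (why it might fail: known in print; for [K:ℚ] odd
with no square-integrable place it rests on Taylor's congruence trick; as typed the L-normalised
Satake clause (arithFrobPolyOfSatake, m = 1) must match Jarvis's Hecke convention — a twist slip
falsifies it.) [Jarvis1997, RogawskiTunnell1983, BoxerPilloni2021HigherColeman,
TaylorInventMath1989]
#7 RegularServed (crux) — (IN-TREE NAMED FACTS, kinded crux for the crux-only deciding theorem) for
every totally real K there are reciprocity data RD serving the regular case: every L-algebraic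
cuspidal π on GL₂(𝔸_K) with a regular infinity type has, for all ℓ, ι, an irreducible ρ with
IsGeometricFramed RD ρ and Corresponds RD ι π ρ — the in-tree named facts
`galoisRep_GL2_totallyReal_localGlobal` (Carayol–Taylor–Blasius–Rogawski–Saito–Skinner–Liu) +
`exists_galoisRep_of_regularAlgebraic` (n = 2) + `galoisRep_GL2_totallyReal_irreducible`, repackaged
as RD := ⟨llc⟩. [difficulty: L] (why it might fail: literature debt, not open: lang.S27 (n = 2) +
galoisRep_GL2_totallyReal_localGlobal + Ribet irreducibility repackaged as RD := ⟨llc⟩; false only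
if the accepted facts mis-render Skinner/Saito (pinned D_pst versus their WD convention).)
[Skinner2009, CarayolASENS1986, TaylorInventMath1989, HarrisTaylorAMS2001]
#8 SectorComplement (crux) — (SECTOR JUNCTION, never staffed; crux only for the crux-only deciding
theorem, as EvenSkinnerWilesMirror.SectorComplement /
BianchiDeligneSerre.ArtinTypeSectorToLanglands) OUT-OF-SCOPE REMAINDER `OddHilbertReciprocity →
Langlands` — everything the thesis does not claim (direction (B), n ≠ 2, fields not totally real,
non-holomorphic or even-sign π); hub convention for sector routes
(E8QuinticResidue.SectorComplement, PicardMuOrdinary.SectorComplement,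
QuadraticWindow.BeyondTheWindow); never staffed from this route; graders judge items 2–5.
[difficulty: open-problem] (why it might fail: it is the rest of the summit (direction (B), n ≠ 2,
non-totally-real K, even-sign/Maass-type π) and closes only with `Langlands` itself.)
[BuzzardGeeLMS2014]

TWO-LAYER PLAN. Foreseen (nothing filed now): NonAlignedAtEll ⇐ PartialDeRhamAtSingular (τ-de Rham
at the singular τ of a non-aligned v, from Sen
nullity + Ding) → SpecialMonodromy (N ≠ 0 at special v ∣ ℓ, the L-invariant/companion statement) →
NonAlignedAtEll; AlignedAtEll ⇐
NoSpecialAligned (π_v non-special at alignable v) → TypeMatchingAligned → AlignedAtEll; AwayFromEll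
⇐ JarvisNonSpecial (support, in
print) → SpecialAway → AwayFromEll — each once the definition requests D1/D2 land.

KILL CRITERIA. (1) ONE partial-weight-one cuspidal newform over a totally real field that is special
(or of infinite projective inertial type) at an
ALIGNABLE place — e.g. weight (1,k) over a real quadratic field, Steinberg at a SPLIT prime —
refutes SingularProjectiveFinite and
AlignedAtEll together with Buzzard–Gee 3.2.2's Hodge–Tate recipe: close `refuted` and escalate (it
would contradict the intended summit).
The refuter's first task is that census: Moy–Specter's Schaeffer-quotient algorithm over ℚ(√5),
levels Γ₀(𝔮) with 𝔮 SPLIT, weights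
[3,1], [5,1]. (2) SingularProjectiveFinite refuted through the ‖τ x‖ / primesAbove / scalar-multiple
packaging ⇒ misstated: restate
embedding-wise once D1 lands. (3) Kisin/BP period continuation shown to fail at weight-one companion
points ⇒ AlignedAtEll loses its
engine ⇒ pivot to Pan-style differential-operator classicality or close `exhausted` with census. (4)
An all-places LGC theorem for
partial weight one in print ⇒ `superseded`.

NOT DECOMPOSED YET. The embedding-wise Sen statement (τ-Hodge–Tate nullity at every singular τ, also
at non-aligned places — needs D1, a Sen-operator
carrier); the special / non-special split of AwayFromEll and AlignedAtEll (needs D2, `IsSpecialAt`);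
ℓ = 2; the parallel-weight-one
sub-case (finite image, Rogawski–Tunnell) which every crux contains as its easy part.

CHEAPEST FALSIFIER. Lookup, DONE: the only published non-CM partial-weight-one forms
(MoySpecter2015: F = ℚ(√5), weight [5,1], level Γ₀(14), χ of
conductor (7)∞₁∞₂, order 6) are Steinberg (up to unramified quadratic twist) at 2, which is INERT in
ℚ(√5) — non-alignable, as the
line predicts (weak admissibility even allows semistable non-crystalline there: Σ_{τ|2}(k_τ − 1) = 4
≥ f = 2). Next cheapest: rerun
their algorithm at split levels (Magma HMF package; not on the kit python/pari lane) — a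
Steinberg-at-split example kills the line.

NUMBERS. Moy–Specter datum: S_[5,1](Γ₀(14), χ) over ℚ(√5) is 2-dimensional, basis over L = ℚ(√5,
χ)(√−19), both non-CM, Steinberg at the
inert prime 2. Weak-admissibility bookkeeping used for the prediction: for K_v unramified of degree
f over ℚ_ℓ with labelled weights
{0, k_τ − 1}, a semistable NON-crystalline rank-2 filtered (φ, N)-module needs Σ_{τ ∣ v}(k_τ − 1) ≥
f (ker N in general position);
with all k_τ = 1 at v this fails for every f ≥ 1, matching Sen: HT weights {m, m} at all τ ∣ v ⇒
potentially unramified after ε^{−m}.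

DEFINITION REQUESTS. D1 (Literature/NumberTheory/PAdicHodge): a Sen-operator / τ-labelled
Hodge–Tate-semisimplicity carrier for `FramedGaloisRep K
(PadicAlgCl ℓ) n` at v ∣ ℓ (generalized HT weights exist in spirit via `labelledHodgeTateWeightsAt`;
semisimplicity does not). D2
(Literature/NumberTheory/Automorphic): `IsSpecialAt v` (local component an unramified twist of
Steinberg) for `CuspidalAutomorphicRepData
2 K hcpt`, to file the prediction 'no special component at alignable places' as its own item. Both
to be filed with `workitem add
--kind definition` after open.

Novelty: Searches (2026-08-16): lit frontier Langlands --since 2022 (60 rows; read arXiv:2603.27937,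
2605.03519, 2603.19768, 2605.18426); lit search
--source arxiv "partial weight one Hilbert modular forms Galois representations" (8:
arXiv:2603.02014, 1508.07722, 2512.02570, 1409.6535,
1409.6533, 2111.04834, 2309.13665), "partially de Rham" (arXiv:1410.4597, 1508.07420), "classicality
Hilbert modular forms locally
analytic" (arXiv:2605.18426 — regular multiweights only), "Sen operator locally analytic Hilbert" (0
relevant); lit galaxy search "partial
weight one" --star all (0), "Sen operator" --star pdf (8, none relevant); lit read
Newton2015LowWeight §1 (p.3–4), MoySpecter2015 §1 +
Rem 1.1 (p.2–4), BoxerPilloni2021HigherColeman Thm 23 / §6.11 (p.10–11, 120–121), DiamondSasaki2025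
Thm 5.1.1 + footnote (p.21),
Jiang2026 set-up (p.3: 'regular multiweight' = k_τ ≠ 1), Ding2014 §0; lean search
(IsHolomorphicHilbert, hilbertInfinityType,
infiniteIdeleSingle, labelledHodgeTateWeightsAt; no Sen operator); grep of 66 Langlands Theses
('partial weight one': CapacityClassicality
allowance only; 'Sen operator': BCGP Sen = Cousin inside (B)-cruxes of
PicardMuOrdinary/TrigonalHeartLimit).
Nearest prior art found: BoxerPilloni2021HigherColeman Thm 23 (3)–(4) (generalized HT WEIGHTS and
regular-principal-series potentially
crystalline LGC for weakly regular odd π); MoySpecter2015 §1 (conditional remark: assuming LGC, ρ_λ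
unramified at one v ∣ ℓ for split ℓ);
Newton2015LowWeight Thm 4 (v ∤ p monodrom  [refs: 2603.27937, 2603.02014, 1410.4597, 2605.18426, MoySpecter2015, DiamondSasaki2025]

Barriers (technique_class: geometric-sen-theory, sen-finiteness, eigenvariety-periods): - technique_class: geometric-sen-theory, sen-finiteness, eigenvariety-periods
- Literature.Barriers.Langlands.NonRegularWeightBarrier: applies (π is non-regular at the weight-one
embeddings) and is evaded on the barrier's own scope caveat: holomorphic limits of discrete series
ARE realised in coherent cohomology and on eigenvarieties (Goldring Thm 4.3.5; Jarvis1997;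
BoxerPilloni Thm 23), ρ exists, and the lever acts on locally analytic completed cohomology where
these eigensystems live; Maass-type components (the barrier's core case) are excluded by the
total-oddness hypothesis, not attacked.
- Literature.Barriers.Langlands.PatchingLocalComponentBarrier: not met — direction (A), no
Taylor–Wiles–Kisin patching anywhere in the line.
- Literature.Barriers.Langlands.ResiduallyReducibleBarrier: not met — no residual-image hypothesis;
ρ̄ reducible is allowed throughout.
- Literature.Barriers.Langlands.ModPLanglandsGL2BeyondQpFpBar: not met — no p-adic or mod-p local
Langlands is used; K_v is arbitrary.
- Literature.Barriers.Langlands.TaylorWilesNumericalCoincidence: not met — no patching (and l₀ = 0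
for GL₂ over totally real K anyway).
- Literature.Barriers.Langlands.ShimuraVarietyRealizationBarrier: not met — K totally real, n = 2:
Hilbert modular varieties and Shimura curves carry the coherent classes and the geometric Sen
theory.
- Negatives index: one refuted statement on the summit (K3KugaSatakeDescent Serre-type anchor,
stmt-Langlands-3797) — unrelated; no refuted statement c

History (route lifecycle, newest last):
- 2026-08-16T18:18:50Z · rev 1: restated Assembly (stmt-Langlands-16309) — prepare crux-only closes: Assembly no longer routes through UniqueUpToConjugacy (planner-plan-novel-Langlands-Langlands-e266a39d-a-v2-g4-0)
- 2026-08-16T18:20:05Z · rev 3: restated OddHilbertReciprocity (stmt-Langlands-16300) — crux-only closes (ruling 2026-08-16): target restated without the uniqueness clause (theorem given existence); closes assumes the 7 cruxes only (planner-plan-novel-Langlands-Langlands-e266a39d-a-v2-g4-0)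
- 2026-08-16T18:20:28Z · rev 4: dropped UniqueUpToConjugacy — not load-bearing: the target no longer restates uniqueness up to conjugacy (a theorem given existence, Chebotarev + Brauer–Nesbitt, cf. the summit docstring); c (planner-plan-novel-Langlands-Langlands-e266a39d-a-v2-g4-0)
- 2026-08-16T18:39:21Z · rev 6: restated OddHilbertReciprocity (stmt-Langlands-16317), SingularProjectiveFinite (stmt-Langlands-16301), NonAlignedAtEll (stmt-Langlands-16302), AlignedAtEll (stmt-Langlands-16303), AwayFromEll (stmt-Langlands-16304), OddNonRegularAttached (stmt-Langlands-16305) — cone route-repair (rrepair-Langlands-SenNullAlign (planner-rrepair-Langlands-SenNullAlignment-2b07ca68-0)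
- 2026-08-23T20:53:18Z · DORMANT — reconciler: no traction for 6.2 d (last activity item-evidence-added at 2026-08-17T14:32:31Z); parked, not closed — `ledger route dormant route-Langlands-SenNul (operator:999:2009728)

sub-problem: Langlands · status: dormant · opened planner-plan-novel-Langlands-Langlands-e266a39d-a-v2-g4-0 2026-08-16T18:16:36Z · rev 7 · ledger route-Langlands-SenNullAlignment
GENERATED by the gate from the ledger (D-0016/17). Provers cite these decls: `theorem foo : Summit.Langlands.Langlands.Theses.SenNullAlignment.<Decl> := …` in Summits/Langlands/Langlands/Theorems/<Name>.lean.
-/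

namespace Summit.Langlands.Langlands.Theses.SenNullAlignment

open scoped BigOperators Topology Manifold Classical MeasureTheory ProbabilityTheory Matrix InnerProductSpace ComplexConjugate ContinuousMap
open Filter Set Function TopologicalSpace MeasureTheory

attribute [summit_statement] _root_.Langlands

-- earlier OddHilbertReciprocity (stmt-Langlands-16300, replaced 2026-08-16T18:20:05Z -> stmt-Langlands-16317): retired by None — ∀ (K : Type) [Field K] [NumberField K], NumberField.IsTotallyReal K → ∃ RD : Summit.Langlands.ReciprocityData K, ∀ (hcpt : Literature.NumberTheory.Automorphic.isCompact_glFiniteIntegralLevel 2 K) (π : Literature.NumberTheory.Automorphic.CuspidalAutomorphicRepData 2 K hcpt)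
-- earlier OddHilbertReciprocity (stmt-Langlands-16317, replaced 2026-08-16T18:39:21Z -> stmt-Langlands-16357): retired by None — ∀ (K : Type) [Field K] [NumberField K], NumberField.IsTotallyReal K → ∃ RD : Summit.Langlands.ReciprocityData K, ∀ (hcpt : Literature.NumberTheory.Automorphic.isCompact_glFiniteIntegralLevel 2 K) (π : Literature.NumberTheory.Automorphic.CuspidalAutomorphicRepData 2 K hcpt)
/-- item stmt-Langlands-16357 · target · rank 0 · open · by planner
why it might fail: It is Buzzard–Gee 3.2.2 / Taylor Conj. 7 for partial weight one: a non-CM partial-weight-one newform whose attached ρ has N = 0 at a special place for some ℓ, or is not de Rham above ℓ, refutes it; as typed only through the ∃RD / pinned-pst conventions shared with the summit.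
sources: Jarvis1997, Newton2015LowWeight, MoySpecter2015, BuzzardGeeLMS2014, Skinner2009
[target] direction (A) of the summit for n = 2 over totally real K restricted to L-algebraic
cuspidal π holomorphic of weight (k, w) with totally odd central sign: ∀ K totally real ∃ RD ∀ such
π ∀ ℓ ι ∃ ρ irreducible, IsGeometricFramed RD ρ, Corresponds RD ι π ρ. Uniqueness up to conjugacy (a
theorem given existence: Chebotarev + Brauer–Nesbitt) is deliberately NOT restated — the route's
content is existence + compatibility; partial/parallel weight one is the open part, odd regular
weights the in-tree fact. [cone repair 2026-08-16: typed over the cone of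
Summits.Langlands.Statement + Mathlib alone — "holomorphic of weight (k, w)" is π.1.HasInfinityType
of the inlined weight-(k,w) infinity type (definitionally `hilbertInfinityType k w`, so
`IsHolomorphicHilbert k w` by Iff.rfl) and the idèle −1 at the infinite place u is the Mathlib term
Units.map inl (Units.map (mulSingle _ u) (−1)) (definitionally `infiniteIdeleSingle u (-1)`);
meaning unchanged (Iff.rfl with the previous decl).] -/
@[route_item "route-Langlands-SenNullAlignment"]
def OddHilbertReciprocity : Prop :=
  ∀ (K : Type) [Field K] [NumberField K], NumberField.IsTotallyReal K → ∃ RD : Summit.Langlands.ReciprocityData K, ∀ (hcpt : Literature.NumberTheory.Automorphic.isCompact_glFiniteIntegralLevel 2 K) (π : Literature.NumberTheory.Automorphic.CuspidalAutomorphicRepData 2 K hcpt) (k : (K →+* ℂ) → ℕ) (w : ℤ), π.1.IsLAlgebraic → π.1.HasInfinityType (fun β : K →+* ℂ => ({(⟨((k β : ℂ) - 1 - w) / 2, (1 - (k β : ℂ) - w) / 2, (k β : ℤ) - 1, by push_cast; ring⟩ : Literature.NumberTheory.Automorphic.ArchWeight), (⟨((k β : ℂ) - 1 - w) / 2, (1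 - (k β : ℂ) - w) / 2, (k β : ℤ) - 1, by push_cast; ring⟩ : Literature.NumberTheory.Automorphic.ArchWeight).swap} : Multiset Literature.NumberTheory.Automorphic.ArchWeight)) → (∀ (u : NumberField.InfinitePlace K), ∀ φ ∈ π.1.W, Literature.NumberTheory.Automorphic.rightTranslation (Literature.NumberTheory.Automorphic.AdelicGroupData.gl 2 K) (Matrix.GeneralLinearGroup.scalar (Fin 2) (Units.map (MonoidHom.inl (NumberField.InfiniteAdeleRing K) (IsDedekindDomain.FiniteAdeleRing (NumberField.RingOfIntegers K) K) : NumberField.InfiniteAdeleRing K →* NumberField.AdeleRing (NumberField.RingOfIntegers K) K) (Units.map (MonoidHom.mulSingle (fun u' : NumberField.InfinitePlace K => u'.Completion) u : u.Completion →* NumberField.InfiniteAdeleRing K) (-1)))) φ + φ ∈ π.1.W') → ∀ (ℓ : ℕ) [Fact ℓ.Prime] (ι : PadicAlgCl ℓ ≃+* ℂ), ∃ ρ : Literature.NumberTheory.GaloisRepresentations.FramedGaloisRep K (PadicAlgCl ℓ) 2, ρ.toGaloisRep.IsIrreducible ∧ Summit.Langlands.IsGeometricFramed RD ρ ∧ Summit.Langlands.Corresponds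 RD ι π.1 ρ

-- earlier SingularProjectiveFinite (stmt-Langlands-16301, replaced 2026-08-16T18:39:21Z -> stmt-Langlands-16358): retired by None — ∀ (K : Type) [Field K] [NumberField K], NumberField.IsTotallyReal K → ∀ (hcpt : Literature.NumberTheory.Automorphic.isCompact_glFiniteIntegralLevel 2 K) (π : Literature.NumberTheory.Automorphic.CuspidalAutomorphicRepData 2 K hcpt) (k : (K →+* ℂ) → ℕ) (w : ℤ), π.1.IsLAlg
/-- item stmt-Langlands-16358 · crux · rank 2 · open · by planner
why it might fail: needs Sen SEMISIMPLICITY (Θ_τ = 0), not the known Sen weights: a classical partial-weight-one π whose ρ is τ-Hodge–Tate-defective at an aligned place (nothing proved forbids it; cf. non-classical weight-1 points in Pan II) refutes it; it also asserts the HT recipe (BG Rem. 3.2.3) the summit omits.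
sources: Sen1973, BoxerPilloni2021HigherColeman, PanLocallyAnalyticII2022, RodriguezCamargo2022GeometricSen, Jiang2026ClassicalityHilbert, MoySpecter2015
[crux] (THE LEVER) K totally real; π cuspidal on GL₂(𝔸_K), L-algebraic, holomorphic of weight (k,
w), totally odd, with some k_β = 1; ℓ, ι; ρ : Γ_K → GL₂(ℚ̄_ℓ) irreducible and Satake–Frobenius
compatible with π at almost all v. Then at every v ∣ ℓ all of whose ℓ-adic embeddings τ : K → ℚ̄_ℓ
(those with ‖τ x‖ < 1 on v) read weight one, k(ι ∘ τ) = 1, the image of every inertia group above v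
under ρ is finite modulo scalars. Intended proof: Sen weights {m, m} at such τ (BoxerPilloni Thm 23
(3)) + τ-Hodge–Tate NULLITY of the classical eigensystem via geometric Sen theory (π_HT differential
operators on the perfectoid Hilbert modular variety; Pan II §§5–6 for modular curves, Jiang 2026 for
regular Hilbert weights) + Sen 1973 (Θ = 0 ⇒ finite inertia after the cyclotomic twist ε^m).
[difficulty: open-problem] [cone repair 2026-08-16: typed over the cone of
Summits.Langlands.Statement + Mathlib alone — "holomorphic of weight (k, w)" is π.1.HasInfinityType
of the inlined weight-(k,w) infinity type (definitionally `hilbertInfinityType k w`, so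
`IsHolomorphicHilbert k w` by Iff.rfl) and the idèle −1 at the infinite place u is the Mathlib term
Units.map inl (Units.map (mulSingle _ u) (−1)) (de -/
@[route_item "route-Langlands-SenNullAlignment", crux]
def SingularProjectiveFinite : Prop :=
  ∀ (K : Type) [Field K] [NumberField K], NumberField.IsTotallyReal K → ∀ (hcpt : Literature.NumberTheory.Automorphic.isCompact_glFiniteIntegralLevel 2 K) (π : Literature.NumberTheory.Automorphic.CuspidalAutomorphicRepData 2 K hcpt) (k : (K →+* ℂ) → ℕ) (w : ℤ), π.1.IsLAlgebraic → π.1.HasInfinityType (fun β : K →+* ℂ => ({(⟨((k β : ℂ) - 1 - w) / 2, (1 - (k β : ℂ) - w) / 2, (k β : ℤ) - 1, by push_cast; ring⟩ : Literature.NumberTheory.Automorphic.ArchWeight), (⟨((k β : ℂ) - 1 - w) / 2, (1 - (k β : ℂ) - w) / 2, (k β : ℤ) - 1, by push_cast; ring⟩ : Literature.NumberTheory.Automorphic.ArchWeight).swap} : Multiset Literature.NumberTheory.Automorphic.ArchWeight)) → (∀ (u : NumberField.InfinitePlace K), ∀ φ ∈ π.1.W, Literature.NumberTheory.Automorphic.rightTranslation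 (Literature.NumberTheory.Automorphic.AdelicGroupData.gl 2 K) (Matrix.GeneralLinearGroup.scalar (Fin 2) (Units.map (MonoidHom.inl (NumberField.InfiniteAdeleRing K) (IsDedekindDomain.FiniteAdeleRing (NumberField.RingOfIntegers K) K) : NumberField.InfiniteAdeleRing K →* NumberField.AdeleRing (NumberField.RingOfIntegers K) K) (Units.map (MonoidHom.mulSingle (fun u' : NumberField.InfinitePlace K => u'.Completion) u : u.Completion →* NumberField.InfiniteAdeleRing K) (-1)))) φ + φ ∈ π.1.W') → (∃ β : K →+* ℂ, k β = 1) → ∀ (ℓ : ℕ) [Fact ℓ.Prime] (ι : PadicAlgCl ℓ ≃+* ℂ) (ρ : Literature.NumberTheory.GaloisRepresentations.FramedGaloisRep K (PadicAlgCl ℓ) 2), ρ.toGaloisRep.IsIrreducible → (∀ᶠ v : IsDedekindDomain.HeightOneSpectrum (NumberField.RingOfIntegers K) in Filter.cofinite, Summit.Langlands.SatakeFrobCompatibleAt ι π.1 ρ v) → ∀ (v : IsDedekindDomain.HeightOneSpectrum (NumberField.RingOfIntegers K)), ((ℓ : ℕ) : NumberField.RingOfIntegers K) ∈ v.asIdeal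 → (∀ τ : K →+* PadicAlgCl ℓ, (∀ x : NumberField.RingOfIntegers K, x ∈ v.asIdeal → ‖τ x‖ < 1) → k ((ι : PadicAlgCl ℓ →+* ℂ).comp τ) = 1) → (∀ 𝔓 ∈ v.primesAbove, ∃ S : Finset (GL (Fin 2) (PadicAlgCl ℓ)), ∀ σ ∈ 𝔓.inertia (Field.absoluteGaloisGroup K), ∃ g ∈ S, ∃ c : PadicAlgCl ℓ, ((ρ σ : GL (Fin 2) (PadicAlgCl ℓ)) : Matrix (Fin 2) (Fin 2) (PadicAlgCl ℓ)) = c • ((g : GL (Fin 2) (PadicAlgCl ℓ)) : Matrix (Fin 2) (Fin 2) (PadicAlgCl ℓ)))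

-- earlier NonAlignedAtEll (stmt-Langlands-16302, replaced 2026-08-16T18:39:21Z -> stmt-Langlands-16359): retired by None — ∀ (K : Type) [Field K] [NumberField K], NumberField.IsTotallyReal K → ∀ (RD : Summit.Langlands.ReciprocityData K), (∀ (hcpt' : Literature.NumberTheory.Automorphic.isCompact_glFiniteIntegralLevel 2 K) (π' : Literature.NumberTheory.Automorphic.CuspidalAutomorphicRepData 2 K hcpt')
/-- item stmt-Langlands-16359 · crux · rank 3 · open · by planner
why it might fail: N ≠ 0 at a special v ∣ ℓ for Jarvis's ρ is Newton's 'new idea needed' case verbatim; non-distinguished PS and ℓ = 2 exceptional supercuspidals lack an eigenvariety handle; stated ∀ RD serving regular forms (bets partial-weight-one local components are tempered).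
sources: Newton2015LowWeight, MoySpecter2015, BoxerPilloni2021HigherColeman, Ding2014PartiallyDeRham, Ding2015LinvariantsPartiallyDeRham, Kisin2003
[crux] (HARDEST RESIDUE) for every RD serving the regular Hilbert case (hypothesis: every
L-algebraic cuspidal π' of regular infinity type has, for all ℓ', ι', an irreducible geometric ρ'
with Corresponds RD ι' π' ρ'), every π, ρ as in SingularProjectiveFinite and every v ∣ ℓ that is NOT
fully aligned: LocalGlobalCompatibleAt RD ι π ρ v and ρ|Γ_{K_v} is de Rham for Fontaine's pinned
datum. Contains the printed open case — π_v special at an inert-type place (Moy–Specter: Steinberg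
at the inert 2 of ℚ(√5)), i.e. semistable non-crystalline LGC with N ≠ 0 for a congruence-built ρ;
after Sen-nullity at the singular τ and Ding's automatic τ-de Rhamness at the regular τ (weights
differ by k_τ − 1 ≥ 2) it is Kisin-type period matching plus ONE monodromy statement; BoxerPilloni
Thm 23 (4) already covers π_v a regular principal series. [deps: SingularProjectiveFinite]
[difficulty: open-problem] [cone repair 2026-08-16: typed over the cone of
Summits.Langlands.Statement + Mathlib alone — "holomorphic of weight (k, w)" is π.1.HasInfinityType
of the inlined weight-(k,w) infinity type (definitionally `hilbertInfinityType k w`, so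
`IsHolomorphicHilbert k w` by Iff.rfl) and the idèle −1 at the inf -/
@[route_item "route-Langlands-SenNullAlignment", crux]
def NonAlignedAtEll : Prop :=
  ∀ (K : Type) [Field K] [NumberField K], NumberField.IsTotallyReal K → ∀ (RD : Summit.Langlands.ReciprocityData K), (∀ (hcpt' : Literature.NumberTheory.Automorphic.isCompact_glFiniteIntegralLevel 2 K) (π' : Literature.NumberTheory.Automorphic.CuspidalAutomorphicRepData 2 K hcpt'), π'.1.IsLAlgebraic → (∃ T : Literature.NumberTheory.Automorphic.InfinityType K 2, π'.1.HasInfinityType T ∧ T.IsRegular) → ∀ (ℓ' : ℕ) [Fact ℓ'.Prime] (ι' : PadicAlgCl ℓ' ≃+* ℂ), ∃ ρ' : Literature.NumberTheory.GaloisRepresentations.FramedGaloisRep K (PadicAlgCl ℓ') 2, ρ'.toGaloisRep.IsIrreducible ∧ Summit.Langlands.IsGeometricFramed RD ρ' ∧ Summit.Langlands.Corresponds RD ι' π'.1 ρ') → ∀ (hcpt : Literature.NumberTheory.Automorphic.isCompact_glFiniteIntegralLevel 2 K) (π : Literature.NumberTheory.Automorphic.CuspidalAutomorphicRepData 2 K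 hcpt) (k : (K →+* ℂ) → ℕ) (w : ℤ), π.1.IsLAlgebraic → π.1.HasInfinityType (fun β : K →+* ℂ => ({(⟨((k β : ℂ) - 1 - w) / 2, (1 - (k β : ℂ) - w) / 2, (k β : ℤ) - 1, by push_cast; ring⟩ : Literature.NumberTheory.Automorphic.ArchWeight), (⟨((k β : ℂ) - 1 - w) / 2, (1 - (k β : ℂ) - w) / 2, (k β : ℤ) - 1, by push_cast; ring⟩ : Literature.NumberTheory.Automorphic.ArchWeight).swap} : Multiset Literature.NumberTheory.Automorphic.ArchWeight)) → (∀ (u : NumberField.InfinitePlace K), ∀ φ ∈ π.1.W, Literature.NumberTheory.Automorphic.rightTranslation (Literature.NumberTheory.Automorphic.AdelicGroupData.gl 2 K) (Matrix.GeneralLinearGroup.scalar (Fin 2) (Units.map (MonoidHom.inl (NumberField.InfiniteAdeleRing K) (IsDedekindDomain.FiniteAdeleRing (NumberField.RingOfIntegers K) K) : NumberField.InfiniteAdeleRing K →* NumberField.AdeleRing (NumberField.RingOfIntegers K) K) (Units.map (MonoidHom.mulSingle (fun u' : NumberField.InfinitePlace K => u'.Completion) u : u.Completion →* NumberField.InfiniteAdeleRing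 K) (-1)))) φ + φ ∈ π.1.W') → (∃ β : K →+* ℂ, k β = 1) → ∀ (ℓ : ℕ) [Fact ℓ.Prime] (ι : PadicAlgCl ℓ ≃+* ℂ) (ρ : Literature.NumberTheory.GaloisRepresentations.FramedGaloisRep K (PadicAlgCl ℓ) 2), ρ.toGaloisRep.IsIrreducible → (∀ᶠ v : IsDedekindDomain.HeightOneSpectrum (NumberField.RingOfIntegers K) in Filter.cofinite, Summit.Langlands.SatakeFrobCompatibleAt ι π.1 ρ v) → ∀ (v : IsDedekindDomain.HeightOneSpectrum (NumberField.RingOfIntegers K)) (hv : ((ℓ : ℕ) : NumberField.RingOfIntegers K) ∈ v.asIdeal), ¬ (∀ τ : K →+* PadicAlgCl ℓ, (∀ x : NumberField.RingOfIntegers K, x ∈ v.asIdeal → ‖τ x‖ < 1) → k ((ι : PadicAlgCl ℓ →+* ℂ).comp τ) = 1) → Summit.Langlands.LocalGlobalCompatibleAt RD ι π.1 ρ v ∧ (RD.pst ℓ v hv).IsDeRhamFramed (ρ.toLocal v)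

-- earlier AlignedAtEll (stmt-Langlands-16303, replaced 2026-08-16T18:39:21Z -> stmt-Langlands-16360): retired by None — ∀ (K : Type) [Field K] [NumberField K], NumberField.IsTotallyReal K → ∀ (RD : Summit.Langlands.ReciprocityData K), (∀ (hcpt' : Literature.NumberTheory.Automorphic.isCompact_glFiniteIntegralLevel 2 K) (π' : Literature.NumberTheory.Automorphic.CuspidalAutomorphicRepData 2 K hcpt'), π
/-- item stmt-Langlands-16360 · crux · rank 4 · open · by planner
why it might fail: at an aligned v with π_v special it needs an automorphic contradiction (Galois N = 0 vs Steinberg) nobody has derived; supercuspidal π_v at ℓ = 2 after base change; weight-one companion/critical points of the eigenvariety where Kisin's period argument degenerates.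
sources: BoxerPilloni2021HigherColeman, Kisin2003, Skinner2009, HarrisTaylorAMS2001, Newton2015LowWeight
[crux] same setting; v ∣ ℓ fully aligned and the inertia image finite modulo scalars (the output of
SingularProjectiveFinite): then LocalGlobalCompatibleAt RD ι π ρ v and de Rham at v. Content: ρ|Γ_v
≅ χ ⊗ ρ₀ with ρ₀ potentially unramified, so de Rham ⇔ χ Hodge–Tate; WD matching = Galois type of ρ₀
versus inertial type of π_v and Frobenius versus U_v — Kisin/Boxer–Pilloni crystalline periods on
the Hilbert eigenvariety after a solvable totally real base change killing the type, Brauer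
induction on the Weil side; it FORCES π_v non-special at every alignable place (the route's
falsifiable prediction: no partial-weight-one newform is Steinberg at a split prime carrying weight
one). [deps: SingularProjectiveFinite] [difficulty: XL] [cone repair 2026-08-16: typed over the cone
of Summits.Langlands.Statement + Mathlib alone — "holomorphic of weight (k, w)" is
π.1.HasInfinityType of the inlined weight-(k,w) infinity type (definitionally `hilbertInfinityType k
w`, so `IsHolomorphicHilbert k w` by Iff.rfl) and the idèle −1 at the infinite place u is the
Mathlib term Units.map inl (Units.map (mulSingle _ u) (−1)) (definitionally `infiniteIdeleSingle u
(-1)`); meaning unchanged (Iff.rfl with -/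
@[route_item "route-Langlands-SenNullAlignment", crux]
def AlignedAtEll : Prop :=
  ∀ (K : Type) [Field K] [NumberField K], NumberField.IsTotallyReal K → ∀ (RD : Summit.Langlands.ReciprocityData K), (∀ (hcpt' : Literature.NumberTheory.Automorphic.isCompact_glFiniteIntegralLevel 2 K) (π' : Literature.NumberTheory.Automorphic.CuspidalAutomorphicRepData 2 K hcpt'), π'.1.IsLAlgebraic → (∃ T : Literature.NumberTheory.Automorphic.InfinityType K 2, π'.1.HasInfinityType T ∧ T.IsRegular) → ∀ (ℓ' : ℕ) [Fact ℓ'.Prime] (ι' : PadicAlgCl ℓ' ≃+* ℂ), ∃ ρ' : Literature.NumberTheory.GaloisRepresentations.FramedGaloisRep K (PadicAlgCl ℓ') 2, ρ'.toGaloisRep.IsIrreducible ∧ Summit.Langlands.IsGeometricFramed RD ρ' ∧ Summit.Langlands.Corresponds RD ι' π'.1 ρ') → ∀ (hcpt : Literature.NumberTheory.Automorphic.isCompact_glFiniteIntegralLevel 2 K) (π : Literature.NumberTheory.Automorphic.CuspidalAutomorphicRepData 2 K hcpt) (k : (K →+* ℂ) → ℕ) (w : ℤ), π.1.IsLAlgebraic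 → π.1.HasInfinityType (fun β : K →+* ℂ => ({(⟨((k β : ℂ) - 1 - w) / 2, (1 - (k β : ℂ) - w) / 2, (k β : ℤ) - 1, by push_cast; ring⟩ : Literature.NumberTheory.Automorphic.ArchWeight), (⟨((k β : ℂ) - 1 - w) / 2, (1 - (k β : ℂ) - w) / 2, (k β : ℤ) - 1, by push_cast; ring⟩ : Literature.NumberTheory.Automorphic.ArchWeight).swap} : Multiset Literature.NumberTheory.Automorphic.ArchWeight)) → (∀ (u : NumberField.InfinitePlace K), ∀ φ ∈ π.1.W, Literature.NumberTheory.Automorphic.rightTranslation (Literature.NumberTheory.Automorphic.AdelicGroupData.gl 2 K) (Matrix.GeneralLinearGroup.scalar (Fin 2) (Units.map (MonoidHom.inl (NumberField.InfiniteAdeleRing K) (IsDedekindDomain.FiniteAdeleRing (NumberField.RingOfIntegers K) K) : NumberField.InfiniteAdeleRing K →* NumberField.AdeleRing (NumberField.RingOfIntegers K) K) (Units.map (MonoidHom.mulSingle (fun u' : NumberField.InfinitePlace K => u'.Completion) u : u.Completion →* NumberField.InfiniteAdeleRing K) (-1)))) φ + φ ∈ π.1.W') → (∃ β : K →+* ℂ,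 k β = 1) → ∀ (ℓ : ℕ) [Fact ℓ.Prime] (ι : PadicAlgCl ℓ ≃+* ℂ) (ρ : Literature.NumberTheory.GaloisRepresentations.FramedGaloisRep K (PadicAlgCl ℓ) 2), ρ.toGaloisRep.IsIrreducible → (∀ᶠ v : IsDedekindDomain.HeightOneSpectrum (NumberField.RingOfIntegers K) in Filter.cofinite, Summit.Langlands.SatakeFrobCompatibleAt ι π.1 ρ v) → ∀ (v : IsDedekindDomain.HeightOneSpectrum (NumberField.RingOfIntegers K)) (hv : ((ℓ : ℕ) : NumberField.RingOfIntegers K) ∈ v.asIdeal), (∀ τ : K →+* PadicAlgCl ℓ, (∀ x : NumberField.RingOfIntegers K, x ∈ v.asIdeal → ‖τ x‖ < 1) → k ((ι : PadicAlgCl ℓ →+* ℂ).comp τ) = 1) → (∀ 𝔓 ∈ v.primesAbove, ∃ S : Finset (GL (Fin 2) (PadicAlgCl ℓ)), ∀ σ ∈ 𝔓.inertia (Field.absoluteGaloisGroup K), ∃ g ∈ S, ∃ c : PadicAlgCl ℓ, ((ρ σ : GL (Fin 2) (PadicAlgCl ℓ)) : Matrix (Fin 2) (Fin 2) (PadicAlgCl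 ℓ)) = c • ((g : GL (Fin 2) (PadicAlgCl ℓ)) : Matrix (Fin 2) (Fin 2) (PadicAlgCl ℓ))) → Summit.Langlands.LocalGlobalCompatibleAt RD ι π.1 ρ v ∧ (RD.pst ℓ v hv).IsDeRhamFramed (ρ.toLocal v)

-- earlier AwayFromEll (stmt-Langlands-16304, replaced 2026-08-16T18:39:21Z -> stmt-Langlands-16361): retired by None — ∀ (K : Type) [Field K] [NumberField K], NumberField.IsTotallyReal K → ∀ (RD : Summit.Langlands.ReciprocityData K), (∀ (hcpt' : Literature.NumberTheory.Automorphic.isCompact_glFiniteIntegralLevel 2 K) (π' : Literature.NumberTheory.Automorphic.CuspidalAutomorphicRepData 2 K hcpt'), π'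
/-- item stmt-Langlands-16361 · crux · rank 5 · open · by planner
why it might fail: the residue is Newton 2015 §1.1's excluded case (N_v ≠ 0 for the ℓ-adic member when π is Steinberg above ℓ): level-lowering + Kassaei gluing has no classicality theorem for Steinberg-at-ℓ partial weight one, and purity (which would give N ≠ 0) is unavailable for congruence-built ρ.
sources: Jarvis1997, Newton2015LowWeight, RogawskiTunnell1983, CarayolASENS1986
[crux] same setting, v ∤ ℓ: LocalGlobalCompatibleAt RD ι π ρ v. In print when π_v is not special
(Jarvis 1997 Thm 1 of Newton's summary; Carayol, Rogawski–Tunnell for parallel weight one) and, when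
π_v is special, under Newton's hypotheses at ℓ (ℓ unramified in K, π_w unramified ℓ-distinguished
principal series ∀ w ∣ ℓ, ρ̄ irreducible); open residue: π_v special while π_w is special at some w
∣ ℓ (by AlignedAtEll only non-alignable w). [difficulty: L] [cone repair 2026-08-16: typed over the
cone of Summits.Langlands.Statement + Mathlib alone — "holomorphic of weight (k, w)" is
π.1.HasInfinityType of the inlined weight-(k,w) infinity type (definitionally `hilbertInfinityType k
w`, so `IsHolomorphicHilbert k w` by Iff.rfl) and the idèle −1 at the infinite place u is the
Mathlib term Units.map inl (Units.map (mulSingle _ u) (−1)) (definitionally `infiniteIdeleSingle u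
(-1)`); meaning unchanged (Iff.rfl with the previous decl).] -/
@[route_item "route-Langlands-SenNullAlignment", crux]
def AwayFromEll : Prop :=
  ∀ (K : Type) [Field K] [NumberField K], NumberField.IsTotallyReal K → ∀ (RD : Summit.Langlands.ReciprocityData K), (∀ (hcpt' : Literature.NumberTheory.Automorphic.isCompact_glFiniteIntegralLevel 2 K) (π' : Literature.NumberTheory.Automorphic.CuspidalAutomorphicRepData 2 K hcpt'), π'.1.IsLAlgebraic → (∃ T : Literature.NumberTheory.Automorphic.InfinityType K 2, π'.1.HasInfinityType T ∧ T.IsRegular) → ∀ (ℓ' : ℕ) [Fact ℓ'.Prime] (ι' : PadicAlgCl ℓ' ≃+* ℂ), ∃ ρ' : Literature.NumberTheory.GaloisRepresentations.FramedGaloisRep K (PadicAlgCl ℓ') 2, ρ'.toGaloisRep.IsIrreducible ∧ Summit.Langlands.IsGeometricFramed RD ρ' ∧ Summit.Langlands.Corresponds RD ι' π'.1 ρ') → ∀ (hcpt : Literature.NumberTheory.Automorphic.isCompact_glFiniteIntegralLevel 2 K) (π : Literature.NumberTheory.Automorphic.CuspidalAutomorphicRepData 2 K hcpt) (k : (K →+*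 ℂ) → ℕ) (w : ℤ), π.1.IsLAlgebraic → π.1.HasInfinityType (fun β : K →+* ℂ => ({(⟨((k β : ℂ) - 1 - w) / 2, (1 - (k β : ℂ) - w) / 2, (k β : ℤ) - 1, by push_cast; ring⟩ : Literature.NumberTheory.Automorphic.ArchWeight), (⟨((k β : ℂ) - 1 - w) / 2, (1 - (k β : ℂ) - w) / 2, (k β : ℤ) - 1, by push_cast; ring⟩ : Literature.NumberTheory.Automorphic.ArchWeight).swap} : Multiset Literature.NumberTheory.Automorphic.ArchWeight)) → (∀ (u : NumberField.InfinitePlace K), ∀ φ ∈ π.1.W, Literature.NumberTheory.Automorphic.rightTranslation (Literature.NumberTheory.Automorphic.AdelicGroupData.gl 2 K) (Matrix.GeneralLinearGroup.scalar (Fin 2) (Units.map (MonoidHom.inl (NumberField.InfiniteAdeleRing K) (IsDedekindDomain.FiniteAdeleRing (NumberField.RingOfIntegers K) K) : NumberField.InfiniteAdeleRing K →* NumberField.AdeleRing (NumberField.RingOfIntegers K) K) (Units.map (MonoidHom.mulSingle (fun u' : NumberField.InfinitePlace K => u'.Completion) u : u.Completion →* NumberField.InfiniteAdeleRing K) (-1))))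 φ + φ ∈ π.1.W') → (∃ β : K →+* ℂ, k β = 1) → ∀ (ℓ : ℕ) [Fact ℓ.Prime] (ι : PadicAlgCl ℓ ≃+* ℂ) (ρ : Literature.NumberTheory.GaloisRepresentations.FramedGaloisRep K (PadicAlgCl ℓ) 2), ρ.toGaloisRep.IsIrreducible → (∀ᶠ v : IsDedekindDomain.HeightOneSpectrum (NumberField.RingOfIntegers K) in Filter.cofinite, Summit.Langlands.SatakeFrobCompatibleAt ι π.1 ρ v) → ∀ (v : IsDedekindDomain.HeightOneSpectrum (NumberField.RingOfIntegers K)), ((ℓ : ℕ) : NumberField.RingOfIntegers K) ∉ v.asIdeal → Summit.Langlands.LocalGlobalCompatibleAt RD ι π.1 ρ v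

/-- item stmt-Langlands-16306 · crux · rank 9 · open · by planner
why it might fail: Literature debt, not open: lang.S27 (n = 2) + galoisRep_GL2_totallyReal_localGlobal + Ribet irreducibility repackaged as RD := ⟨llc⟩ in the L-normalisation; false only if the accepted facts mis-render Skinner/Saito (e.g. pinned D_pst versus their WD convention).
sources: Skinner2009, CarayolASENS1986, TaylorInventMath1989, HarrisTaylorAMS2001
[support] for every totally real K there are reciprocity data RD serving the regular case: every
L-algebraic cuspidal π on GL₂(𝔸_K) with a regular infinity type has, for all ℓ, ι, an irreducible ρ
with IsGeometricFramed RD ρ and Corresponds RD ι π ρ — the in-tree named facts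
`galoisRep_GL2_totallyReal_localGlobal` (Carayol–Taylor–Blasius–Rogawski–Saito–Skinner–Liu) +
`exists_galoisRep_of_regularAlgebraic` (n = 2) + `galoisRep_GL2_totallyReal_irreducible`, repackaged
as RD := ⟨llc⟩. [difficulty: L] -/
@[route_item "route-Langlands-SenNullAlignment", crux]
def RegularServed : Prop :=
  ∀ (K : Type) [Field K] [NumberField K], NumberField.IsTotallyReal K → ∃ RD : Summit.Langlands.ReciprocityData K, (∀ (hcpt' : Literature.NumberTheory.Automorphic.isCompact_glFiniteIntegralLevel 2 K) (π' : Literature.NumberTheory.Automorphic.CuspidalAutomorphicRepData 2 K hcpt'), π'.1.IsLAlgebraic → (∃ T : Literature.NumberTheory.Automorphic.InfinityType K 2, π'.1.HasInfinityType T ∧ T.IsRegular) → ∀ (ℓ' : ℕ) [Fact ℓ'.Prime] (ι' : PadicAlgCl ℓ' ≃+* ℂ), ∃ ρ' : Literature.NumberTheory.GaloisRepresentations.FramedGaloisRep K (PadicAlgCl ℓ') 2, ρ'.toGaloisRep.IsIrreducible ∧ Summit.Langlands.IsGeometricFramed RD ρ' ∧ Summit.Langlands.Corresponds RD ι' π'.1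 ρ')

/-- item stmt-Langlands-16308 · crux · rank 9 · open · by planner
why it might fail: It is the rest of the summit (direction (B), n ≠ 2, non-totally-real K, even-sign/Maass-type π): closes only with `Langlands` itself; kinded crux solely because the deciding theorem may assume crux items only (ruling 2026-08-16); never to be staffed.
sources: BuzzardGeeLMS2014
[support] OUT-OF-SCOPE REMAINDER `OddHilbertReciprocity → Langlands` — everything the thesis does
not claim (direction (B), n ≠ 2, fields not totally real, non-holomorphic or even-sign π); hub
convention for sector routes (E8QuinticResidue.SectorComplement, PicardMuOrdinary.SectorComplement,
QuadraticWindow.BeyondTheWindow); never staffed from this route; graders judge items 2–5.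
[difficulty: open-problem] -/
@[route_item "route-Langlands-SenNullAlignment", crux]
def SectorComplement : Prop :=
  OddHilbertReciprocity → _root_.Langlands

-- earlier OddNonRegularAttached (stmt-Langlands-16305, replaced 2026-08-16T18:39:21Z -> stmt-Langlands-16362): retired by None — ∀ (K : Type) [Field K] [NumberField K], NumberField.IsTotallyReal K → ∀ (hcpt : Literature.NumberTheory.Automorphic.isCompact_glFiniteIntegralLevel 2 K) (π : Literature.NumberTheory.Automorphic.CuspidalAutomorphicRepData 2 K hcpt) (k : (K →+* ℂ) → ℕ) (w : ℤ), π.1.IsLAlgebr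
/-- item stmt-Langlands-16362 · crux · rank 9 · open · by planner
why it might fail: Known in print (Jarvis 1997; Rogawski–Tunnell; BoxerPilloni Thm 23 (1)–(2)); for [K:ℚ] odd with no square-integrable place it rests on Taylor's congruence trick; as typed the L-normalised Satake clause (arithFrobPolyOfSatake, m = 1) must match Jarvis's Hecke convention — a twist slip falsifies it.
sources: Jarvis1997, RogawskiTunnell1983, BoxerPilloni2021HigherColeman, TaylorInventMath1989
[support] existence (known in print): for π as above (some k_β = 1) and every ℓ, ι there is an
irreducible ρ Satake–Frobenius compatible with π at almost all v in the summit's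
arithmetic-Frobenius L-normalisation — Jarvis 1997 (congruences in coherent cohomology; parallel
weight one: Rogawski–Tunnell), irreducibility by Ribet's argument (Jarvis §3 / Taylor), also
BoxerPilloni Thm 23 (1)–(2); the twist bookkeeping is that of the tree's L-normalised regular
statement. [difficulty: L] [cone repair 2026-08-16: typed over the cone of
Summits.Langlands.Statement + Mathlib alone — "holomorphic of weight (k, w)" is π.1.HasInfinityType
of the inlined weight-(k,w) infinity type (definitionally `hilbertInfinityType k w`, so
`IsHolomorphicHilbert k w` by Iff.rfl) and the idèle −1 at the infinite place u is the Mathlib term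
Units.map inl (Units.map (mulSingle _ u) (−1)) (definitionally `infiniteIdeleSingle u (-1)`);
meaning unchanged (Iff.rfl with the previous decl).] -/
@[route_item "route-Langlands-SenNullAlignment", crux]
def OddNonRegularAttached : Prop :=
  ∀ (K : Type) [Field K] [NumberField K], NumberField.IsTotallyReal K → ∀ (hcpt : Literature.NumberTheory.Automorphic.isCompact_glFiniteIntegralLevel 2 K) (π : Literature.NumberTheory.Automorphic.CuspidalAutomorphicRepData 2 K hcpt) (k : (K →+* ℂ) → ℕ) (w : ℤ), π.1.IsLAlgebraic → π.1.HasInfinityType (fun β : K →+* ℂ => ({(⟨((k β : ℂ) - 1 - w) / 2, (1 - (k β : ℂ) - w) / 2, (k β : ℤ) - 1, by push_cast; ring⟩ : Literature.NumberTheory.Automorphic.ArchWeight), (⟨((k β : ℂ) - 1 - w) / 2, (1 - (k β : ℂ) - w) / 2, (k β : ℤ) - 1, by push_cast; ring⟩ : Literature.NumberTheory.Automorphic.ArchWeight).swap} : Multiset Literature.NumberTheory.Automorphic.ArchWeight)) → (∀ (u : NumberField.InfinitePlace K), ∀ φ ∈ π.1.W, Literature.NumberTheory.Automorphic.rightTranslation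 (Literature.NumberTheory.Automorphic.AdelicGroupData.gl 2 K) (Matrix.GeneralLinearGroup.scalar (Fin 2) (Units.map (MonoidHom.inl (NumberField.InfiniteAdeleRing K) (IsDedekindDomain.FiniteAdeleRing (NumberField.RingOfIntegers K) K) : NumberField.InfiniteAdeleRing K →* NumberField.AdeleRing (NumberField.RingOfIntegers K) K) (Units.map (MonoidHom.mulSingle (fun u' : NumberField.InfinitePlace K => u'.Completion) u : u.Completion →* NumberField.InfiniteAdeleRing K) (-1)))) φ + φ ∈ π.1.W') → (∃ β : K →+* ℂ, k β = 1) → ∀ (ℓ : ℕ) [Fact ℓ.Prime] (ι : PadicAlgCl ℓ ≃+* ℂ), ∃ ρ : Literature.NumberTheory.GaloisRepresentations.FramedGaloisRep K (PadicAlgCl ℓ) 2, ρ.toGaloisRep.IsIrreducible ∧ ∀ᶠ v : IsDedekindDomain.HeightOneSpectrum (NumberField.RingOfIntegers K) in Filter.cofinite, Summit.Langlands.SatakeFrobCompatibleAt ι π.1 ρ v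

-- earlier Assembly (stmt-Langlands-16309, replaced 2026-08-16T18:18:50Z -> stmt-Langlands-16316): retired by None — SingularProjectiveFinite → NonAlignedAtEll → AlignedAtEll → AwayFromEll → OddNonRegularAttached → RegularServed → UniqueUpToConjugacy → SectorComplement → _root_.Langlands
/-- item stmt-Langlands-16316 · assembly · rank 1 · open · by planner
sources: BuzzardGeeLMS2014, Newton2015LowWeight
[assembly] SingularProjectiveFinite → NonAlignedAtEll → AlignedAtEll → AwayFromEll →
OddNonRegularAttached → RegularServed → SectorComplement → Langlands (uniqueness clause removed from
the target: a theorem given existence, Chebotarev + Brauer–Nesbitt, not route content). -/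
@[route_item "route-Langlands-SenNullAlignment"]
def Assembly : Prop :=
  SingularProjectiveFinite → NonAlignedAtEll → AlignedAtEll → AwayFromEll → OddNonRegularAttached → RegularServed → SectorComplement → _root_.Langlands

/-! D-0027 §2.1 — DECIDING THEOREM (planner-authored via `route open/edit --closes-file`; by planner-rrepair-Langlands-SenNullAlignment-2b07ca68-0 2026-08-16T18:39:21Z):
its hypotheses are this route's items and its conclusion the sub-problem Statement (glue_lint), and it elaborates with this file. -/

@[closes "route-Langlands-SenNullAlignment"] theorem closes (h1 : SingularProjectiveFinite) (h2 : NonAlignedAtEll) (h3 : AlignedAtEll)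
    (h4 : AwayFromEll) (hA : OddNonRegularAttached) (hR : RegularServed)
    (hC : SectorComplement) : _root_.Langlands := by
  refine hC ?_
  intro K _ _ hK
  obtain ⟨RD, hreg⟩ := hR K hK
  refine ⟨RD, ?_⟩
  intro hcpt π k w hL hhol hodd ℓ _ ι
  by_cases hne : ∃ β : K →+* ℂ, k β = 1
  · obtain ⟨ρ, hirr, hae⟩ := hA K hK hcpt π k w hL hhol hodd hne ℓ ι
    have hplace : ∀ v : IsDedekindDomain.HeightOneSpectrum (NumberField.RingOfIntegers K),
        Summit.Langlands.LocalGlobalCompatibleAt RD ι π.1 ρ v ∧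
          ∀ hv : ((ℓ : ℕ) : NumberField.RingOfIntegers K) ∈ v.asIdeal,
            (RD.pst ℓ v hv).IsDeRhamFramed (ρ.toLocal v) := by
      intro v
      by_cases hv : ((ℓ : ℕ) : NumberField.RingOfIntegers K) ∈ v.asIdeal
      · by_cases hal : (∀ τ : K →+* PadicAlgCl ℓ, (∀ x : NumberField.RingOfIntegers K, x ∈ v.asIdeal → ‖τ x‖ < 1) → k ((ι : PadicAlgCl ℓ →+* ℂ).comp τ) = 1)
        · have h := h3 K hK RD hreg hcpt π k w hL hhol hodd hne ℓ ι ρ hirr hae v hv hal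
            (h1 K hK hcpt π k w hL hhol hodd hne ℓ ι ρ hirr hae v hv hal)
          exact ⟨h.1, fun _ => h.2⟩
        · have h := h2 K hK RD hreg hcpt π k w hL hhol hodd hne ℓ ι ρ hirr hae v hv hal
          exact ⟨h.1, fun _ => h.2⟩
      · exact ⟨h4 K hK RD hreg hcpt π k w hL hhol hodd hne ℓ ι ρ hirr hae v hv, fun hv' => absurd hv' hv⟩
    refine ⟨ρ, hirr, ⟨hae.mono fun v hv => ?_, fun v hv => (hplace v).2 hv⟩, hae, fun v => (hplace v).1⟩
    obtain ⟨α, -, hur, -⟩ := hv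
    exact hur
  · -- no weight-one embedding: the inlined weight-(k, w) infinity type is regular, so RegularServed applies
    have hregT : ∃ T : Literature.NumberTheory.Automorphic.InfinityType K 2,
        π.1.HasInfinityType T ∧ T.IsRegular := by
      refine ⟨_, hhol, ?_⟩
      intro β
      simp only [Multiset.insert_eq_cons, Multiset.map_cons, Multiset.map_singleton,
        Literature.NumberTheory.Automorphic.ArchWeight.swap_a, Multiset.nodup_cons,
        Multiset.mem_singleton, Multiset.nodup_singleton, and_true]
      intro h
      have h1 : ((k β : ℕ) : ℂ) = 1 := by linear_combination h
      exact hne ⟨β, by exact_mod_cast h1⟩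
    obtain ⟨ρ, hirr, hgeo, hcorr⟩ := hreg hcpt π hL hregT ℓ ι
    exact ⟨ρ, hirr, hgeo, hcorr⟩

end Summit.Langlands.Langlands.Theses.SenNullAlignment
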